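import Literature.NumberTheory.GaloisRepresentations.LubinTateNormOperator
import Literature.NumberTheory.GaloisRepresentations.LocalExistenceTameProofs
import HarnessLib

/-!
# The norm groups of the Lubin–Tate extensions: `N(K_π^nˣ) ⊆ ⟨π⟩ · U_F^{(n)}`, proved

Conclusion of step P3 of the programme of `LocalExistenceLubinTate.lean`: the named fact
`Literature.NumberTheory.GaloisRepresentations.exists_abelian_norm_le_lubinTate` (Cassels–Fröhlich VI §3.6
Prop. 6, Cor., §3.8: for a uniformizer `π` and `n ≥ 1` a finite abelian `E ⊆ F̄` of degree `(q-1)q^{n-1}` with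
`π ∈ N(Eˣ)` and `N(Eˣ) ⊆ ⟨π⟩ · U^{(n)}`) is **proved** — `exists_abelian_norm_le_lubinTate_holds` — with
`E = K_π^n` the Lubin–Tate field, and with it the existence theorem of local class field theory from the
reciprocity law alone (`localExistenceTheorem_of_localReciprocityLaw`,
`exists_intermediateField_normSubgroup_eq_of_localReciprocityLaw`), as well as — unconditionally — the
triviality of the universal norm group, `universalNormSubgroup_eq_bot : universalNormSubgroup F = ⊥`
(Serre XIV §6 Cor. 2 (i)), the norm-group input of the limit reciprocity map of
`LocalReciprocityThetaProofs.lean`.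

## Proof (de Shalit I §2.2 (2)–(3) in the absolute case; Cassels–Fröhlich VI §3.6; Serre LF I §6)

Fix `π`, `n`, `E = K_π^{n+1} = F(λ)` (`ltField π n`, `λ = λ_{n+1}`), `d = [E:F] = (q-1)qⁿ`, and Coleman's
operator `𝒩` on `𝒪[F]⟦X⟧` (`colemanNorm hπ n`, `LubinTateColemanNorm.lean`, `LubinTateNormOperator.lean`).
1. `‖λ‖^d = ‖π‖` (`norm_gen_ltField_pow`: `N(-λ) = π` and the conjugates of `λ` have equal absolute value),
   so (`LocalExistenceTameProofs.exists_dominant_term`, `exists_eq_pow_mul_mul_one_add`) `E/F` is totally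
   ramified: every `x ∈ Eˣ` is `λ^i π^k b (1+m)`, `‖b‖ = 1`, `‖m‖ < 1`; and every `y` with `‖y‖ = 1` is
   `h(λ)` for a polynomial `h ∈ 𝒪[F][X]` with unit constant term (`exists_series_of_norm_eq_one`: all
   coordinates in the power basis are integral, `norm_repr_mul_pow_le`, `norm_le_one_of_norm_mul_pow_le`,
   and the constant one is dominant) — Serre LF I §6 Prop. 17–18.
2. `G(E/F)` acts on `λ` through primitive division points: `σλ = [Σ_{i≤n} digit(dᵢ(σ)) πⁱ]λ` with
   `d₀(σ) ≠ 0` (`exists_digits_algEquiv_gen_eq`: `σλ = [a]λ`, and `λ = σ(σ⁻¹λ) = [ab]λ` forces `a` to be a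
   unit), and `σ ↦ d(σ)` is a bijection onto `{d ∈ 𝓀^{n+1} : d₀ ≠ 0}` (`galDigits_bijective`: injective as
   `λ` generates `E`, and both sides have `(q-1)qⁿ` elements) — Cassels–Fröhlich VI §3.6 Prop. 6 (b).
3. Hence `N(h(λ)) = ∏_σ h(σλ)` is the product of `h` over the primitive points of level `n+1`, while
   `(𝒩^{(n+1)}h)(0)` and `(𝒩^{(n)}h)(0)` are the products over all points of levels `n+1` and `n`
   (`prod_evalAt_eq_constantCoeff_colemanNormIter`, the points of level `n` being the digit vectors with
   `d₀ = 0`): **`N(h(λ)) · (𝒩^{(n)}h)(0) = (𝒩^{(n+1)}h)(0)`** (`norm_evalAt_genPt_mul`; de Shalit's (2)).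
4. For `h` with unit constant term, `g = 𝒩h/h ≡ 1 mod π` (de Shalit's (i)), `𝒩^{(n+1)}h = 𝒩^{(n)}g · 𝒩^{(n)}h`,
   so `N(h(λ)) = (𝒩^{(n)}g)(0) ≡ 1 mod π^{n+1}` (iterated (iv); de Shalit's (3)):
   `exists_norm_evalAt_genPt_eq`, hence `exists_norm_mem_higherUnitGroup`: **`N(𝒪_Eˣ) ⊆ U_F^{(n+1)}`**.
5. Assembly (`exists_abelian_norm_le_lubinTate_holds`): `x = (-λ)^i π^k u` with `‖u‖ = 1`, so
   `N(x) = π^{i+kd} N(u) ∈ ⟨π⟩ · U^{(n+1)}`; degree, abelianness and `π = N(-λ) ∈ N(Eˣ)` are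
   `finrank_ltField`, `isAbelianGalois_ltField`, `mem_range_norm_ltField`.
6. `universalNormSubgroup_eq_bot`: a universal norm is a norm from the unramified extensions of degree
   divisible by every `r` (`exists_abelian_norm_eq_pow_mul`), so has valuation `0`, and from every `K_π^n`,
   so lies in `⟨π⟩ · U^{(n)}`, hence in `⋂ₙ U^{(n)} = 1` (the ingredients of Serre's `V_{m,n}` argument for
   Cor. 2 (i), without passing through Thm. 1).

## References

* E. de Shalit, *Iwasawa theory of elliptic curves with complex multiplication* (1987), Ch. I §1.8
  (PDF p. 11: `k_π^n` is class field to `⟨π⟩ · (1 + 𝔭ⁿ)`; `(𝒪/𝔭ⁿ)ˣ ≅ Gal`), §2.1–2.2 (PDF pp. 12–14).  [deShalit1987]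
* J.-P. Serre, *Local class field theory*, Ch. VI of Cassels–Fröhlich (1967), §3.6 Prop. 6 and Cor.,
  §3.8.  [CasselsFrohlichANT1967]
* J.-P. Serre, *Local Fields* (1979), Ch. I §6 Prop. 17–18; Ch. XIV §6 Thm. 1.  [SerreLocalFields1979]

## Mathlib reuse

`Algebra.norm_eq_prod_automorphisms`, `IsGalois.card_aut_eq_finrank`, `Fintype.bijective_iff_injective_and_card`,
`Fintype.card_subtype_compl`, `Function.Bijective.prod_comp`, `Finset.prod_subtype`, `Finset.prod_nbij'`,
`Finset.prod_filter_mul_prod_filter_not`, `PowerSeries.isUnit_iff_constantCoeff`, `PowerSeries.aeval_coe`,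
`IsUltrametricDist.norm_sum_eq_sup'_of_pairwise_ne`, `IsUltrametricDist.norm_add_eq_max_of_norm_ne_norm`,
`pow_lt_pow_right_of_lt_one₀`, `zpow_le_zpow_iff_right_of_lt_one₀`; from the tree: `LocalExistenceTameProofs.lean`
(`exists_dominant_term`, `exists_eq_pow_mul_mul_one_add`, `eq_of_norm_mul_pow_eq`), `LubinTateField.lean`
(`finrank_ltField`, `norm_neg_gen_ltField`, `mem_range_norm_ltField`, `minpoly_ltRoot`), `LubinTateTorsion.lean`
(`isGalois_ltField`, `isAbelianGalois_ltField`, `card_roots_ltPolyIter`, `pow_dvd_sub_of_ltSMul_genPt_eq`,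
`eq_of_pow_dvd_sum_digits_sub`, `toUnitBallHom_ltSMul`, `aeval_LTCoeff_eq`, `coe_aeval_integer`),
`LubinTateColemanNorm.lean`, `LubinTateNormOperator.lean`, `LocalExistenceLubinTate.lean`
(`localExistenceTheorem_of_reciprocityLaw_of_lubinTate`, `higherUnitGroup`).
-/

noncomputable section

open Filter Topology Polynomial ValuativeRel
open scoped PowerSeries.WithPiTopology

namespace Literature.NumberTheory.GaloisRepresentations


/-! ### Coordinates in a totally ramified power basis -/

section Coordinates

variable {K : Type*} [NontriviallyNormedField K] [CompleteSpace K] [IsUltrametricDist K]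
  {L : Type*} [Field L] [Algebra K L] [FiniteDimensional K L]

/-- **Every coordinate is bounded by the norm**: for a power basis with `‖α‖^{[L:K]} = ‖π‖`
(`‖Kˣ‖ = ‖π‖^ℤ`), the terms `c_i α^i` of `y = Σ c_i α^i` have pairwise distinct norms, so each is
bounded by `‖y‖` (ultrametric equality case).  Ref: Serre, *Local Fields*, Ch. I §6 Prop. 17–18;
Cassels–Fröhlich Ch. I §6. [folklore] -/
theorem norm_repr_mul_pow_le {π : K} (hπ0 : 0 < ‖π‖) (hπ : ‖π‖ < 1)
    (hval : ∀ x : K, x ≠ 0 → ∃ k : ℤ, ‖x‖ = ‖π‖ ^ k) (pb : PowerBasis K L)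
    (hα : spectralNorm K L pb.gen ^ pb.dim = ‖π‖) (y : L) (i : Fin pb.dim) :
    ‖pb.basis.repr y i‖ * spectralNorm K L pb.gen ^ (i : ℕ) ≤ spectralNorm K L y := by
  classical
  letI := spectralNorm.normedField K L
  haveI : IsUltrametricDist L :=
    IsUltrametricDist.isUltrametricDist_of_forall_norm_add_le_max_norm
      (fun a b => isNonarchimedean_spectralNorm (K := K) (L := L) a b)
  have hsp : ∀ z : L, spectralNorm K L z = ‖z‖ := fun z => rfl
  set t := spectralNorm K L pb.gen with ht_def
  have ht : 0 < t := by
    rcases (spectralNorm_nonneg (K := K) pb.gen).eq_or_lt with h | h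
    · exfalso
      have ht0 : t = 0 := h.symm
      rw [ht0] at hα
      rcases Nat.eq_zero_or_pos pb.dim with hd | hd
      · rw [hd, pow_zero] at hα
        exact hπ.ne hα.symm
      · rw [zero_pow hd.ne'] at hα
        exact hπ0.ne hα
    · exact h
  set c := pb.basis.repr y with hc
  by_cases hci : c i = 0
  · rw [hci, norm_zero, zero_mul]; exact spectralNorm_nonneg _
  set f : Fin pb.dim → L := fun j => c j • pb.gen ^ (j : ℕ) with hf
  have hyf : y = ∑ j, f j := by
    conv_lhs => rw [← pb.basis.sum_repr y]
    simp only [hf, PowerBasis.coe_basis]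
    rfl
  have hnf : ∀ j, ‖f j‖ = ‖c j‖ * t ^ (j : ℕ) := by
    intro j
    simp only [hf, Algebra.smul_def]
    rw [norm_mul, norm_pow, ← hsp, spectralNorm_extends]
    rfl
  have hfi : f i ≠ 0 := by
    rw [← norm_pos_iff, hnf]
    exact mul_pos (norm_pos_iff.mpr hci) (pow_pos ht _)
  set s' := (Finset.univ : Finset (Fin pb.dim)).filter (fun j => f j ≠ 0) with hs'_def
  have his' : i ∈ s' := by rw [hs'_def, Finset.mem_filter]; exact ⟨Finset.mem_univ _, hfi⟩
  have hs'ne : s'.Nonempty := ⟨i, his'⟩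
  have hsum : ∑ j, f j = ∑ j ∈ s', f j := by rw [hs'_def, Finset.sum_filter_ne_zero]
  have hpw : Set.Pairwise (s' : Set (Fin pb.dim)) (fun j k => ‖f j‖ ≠ ‖f k‖) := by
    intro j hj k hk hjk h
    rw [Finset.mem_coe, hs'_def, Finset.mem_filter] at hj hk
    have hcj : c j ≠ 0 := by intro h0; apply hj.2; simp [hf, h0]
    have hck : c k ≠ 0 := by intro h0; apply hk.2; simp [hf, h0]
    rw [hnf, hnf] at h
    exact hjk (Fin.ext (eq_of_norm_mul_pow_eq hπ0 hπ hval ht hα hcj hck j.2 k.2 h))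
  rw [hsp, hyf, hsum, IsUltrametricDist.norm_sum_eq_sup'_of_pairwise_ne hs'ne hpw, ← hnf]
  exact Finset.le_sup' (fun j => ‖f j‖) his'

omit [CompleteSpace K] [IsUltrametricDist K] in
/-- If `‖a‖ t^i ≤ 1` with `i < d`, `t^d = ‖π‖` and `‖Kˣ‖ = ‖π‖^ℤ`, then `‖a‖ ≤ 1` (`‖a‖ ≤ t^{-i} < ‖π‖⁻¹`
and discreteness). [folklore] -/
theorem norm_le_one_of_norm_mul_pow_le {π : K} (hπ0 : 0 < ‖π‖) (hπ : ‖π‖ < 1)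
    (hval : ∀ x : K, x ≠ 0 → ∃ k : ℤ, ‖x‖ = ‖π‖ ^ k) {t : ℝ} {d : ℕ} (ht : 0 < t) (htd : t ^ d = ‖π‖)
    {a : K} {i : ℕ} (hi : i < d) (h : ‖a‖ * t ^ i ≤ 1) : ‖a‖ ≤ 1 := by
  by_cases ha : a = 0
  · rw [ha, norm_zero]; exact zero_le_one
  obtain ⟨k, hk⟩ := hval a ha
  by_contra hgt
  push Not at hgt
  have ht1 : t < 1 := by
    by_contra hge
    push Not at hge
    have : 1 ≤ t ^ d := one_le_pow₀ hge
    rw [htd] at this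
    exact absurd (this.trans_lt hπ) (lt_irrefl _)
  -- `k ≤ -1`
  have hk1 : k ≤ -1 := by
    by_contra hk0
    push Not at hk0
    have hk0' : 0 ≤ k := by omega
    have : ‖a‖ ≤ 1 := by
      rw [hk, ← Int.toNat_of_nonneg hk0', zpow_natCast]
      exact pow_le_one₀ (norm_nonneg _) hπ.le
    exact absurd (this.trans_lt hgt) (lt_irrefl _)
  have h1 : ‖π‖ ^ (-1 : ℤ) ≤ ‖a‖ := by
    rw [hk, zpow_le_zpow_iff_right_of_lt_one₀ hπ0 hπ]
    exact hk1
  have h2 : t ^ d < t ^ i := pow_lt_pow_right_of_lt_one₀ ht ht1 hi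
  have h3 : 1 < ‖a‖ * t ^ i :=
    calc (1 : ℝ) = ‖π‖ ^ (-1 : ℤ) * t ^ d := by
          rw [htd, zpow_neg_one, inv_mul_cancel₀ hπ0.ne']
      _ < ‖π‖ ^ (-1 : ℤ) * t ^ i := mul_lt_mul_of_pos_left h2 (zpow_pos hπ0 _)
      _ ≤ ‖a‖ * t ^ i := by gcongr
  exact absurd (h.trans_lt h3) (lt_irrefl _)

end Coordinates

section LocalFieldC

open GaloisRepresentations.IsNonarchimedeanLocalField LubinTate

variable (F : Type*) [Field F] [ValuativeRel F] [TopologicalSpace F] [IsNonarchimedeanLocalField F]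

attribute [local instance] ltNormUniformSpace ltNormIsUniformAddGroup rk1 nF nE fintypeResidueField

section NormComputation

variable {F}
variable {π : 𝒪[F]} (hπ : (valuation F).IsUniformizer (π : F)) (n : ℕ)

/-- Coefficients of `𝒪[F]` inside `E`: `ι x ∈ 𝒪_E ⊆ E` is `algebraMap F E x` (unfolding). [folklore] -/
theorem coe_algebraMap_LTCoeff (E : IntermediateField F (AlgebraicClosure F)) [FiniteDimensional F E]
    (x : LTCoeff F) : ((algebraMap (LTCoeff F) (unitBall E) x : unitBall E) : E) =
      algebraMap F E (((LTCoeff.of F).symm x : 𝒪[F]) : F) := rfl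

/-- The value `h(x) ∈ 𝒪_E` of `h = X` is `x`. [folklore] -/
theorem evalAt_X' (E : IntermediateField F (AlgebraicClosure F)) [FiniteDimensional F E]
    (x : (maxNilIdeal F E).toIdeal) :
    evalAt (maxNilIdeal F E) x (PowerSeries.X : PowerSeries (LTCoeff F)) = (x : unitBall E) := by
  rw [evalAt_eq_evS_map, PowerSeries.map_X, evS_X]

include hπ in
/-- **`‖λ_{n+1}‖^{[K_π^{n+1} : F]} = ‖π‖`** (`N(-λ) = π` and all conjugates have the same absolute value).
[cite: CasselsFrohlichANT1967, Ch. VI §3.6 Cor. to Prop. 6] -/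
theorem norm_gen_ltField_pow :
    ‖(IntermediateField.AdjoinSimple.gen F (ltRoot π n) : ltField π n)‖ ^
        ((residueFieldCard F - 1) * residueFieldCard F ^ n) = ‖(π : F)‖ := by
  haveI := isGalois_ltField hπ n
  set g := (IntermediateField.AdjoinSimple.gen F (ltRoot π n) : ltField π n)
  have h1 := Algebra.norm_eq_prod_automorphisms F (-g)
  rw [norm_neg_gen_ltField π hπ n] at h1
  have h2 := congrArg (fun z : ltField π n => ‖z‖) h1
  rw [norm_eq_spectralNorm F (ltField π n) (algebraMap F (ltField π n) _), spectralNorm_extends,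
    norm_prod] at h2
  rw [h2, Finset.prod_congr rfl fun σ _ => (norm_algEquiv σ (-g)).trans (norm_neg g), Finset.prod_const,
    Finset.card_univ, ← finrank_ltField π hπ n, ← IsGalois.card_aut_eq_finrank, Nat.card_eq_fintype_card]

include hπ in
/-- The discrete value group of `F` in norm form: `‖x‖ = ‖π‖^k`. [folklore] -/
theorem exists_norm_eq_norm_zpow {x : F} (hx : x ≠ 0) : ∃ k : ℤ, ‖x‖ = ‖(π : F)‖ ^ k := by
  obtain ⟨k, hk⟩ := exists_valuation_eq_unifValue_zpow F hx
  refine ⟨k, ?_⟩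
  have hπv : valuation F (π : F) = unifValue F := hπ
  rw [← norm_zpow]
  refine le_antisymm ?_ ?_
  · rw [Valued.toNormedField.norm_le_iff]
    change valuation F x ≤ valuation F ((π : F) ^ k)
    rw [map_zpow₀, hπv, hk]
  · rw [Valued.toNormedField.norm_le_iff]
    change valuation F ((π : F) ^ k) ≤ valuation F x
    rw [map_zpow₀, hπv, hk]

/-! #### The Galois group of `K_π^{n+1}/F` and the primitive division points -/

/-- Every automorphism sends `λ_{n+1}` to some `[a] λ_{n+1}`.
[cite: CasselsFrohlichANT1967, Ch. VI §3.6 Prop. 6 (b)] -/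
theorem exists_algEquiv_gen_eq (σ : ltField π n ≃ₐ[F] ltField π n) : ∃ a : 𝒪[F],
    σ (IntermediateField.AdjoinSimple.gen F (ltRoot π n)) =
      ((ltSMul (maxNilIdeal F (ltField π n)) (isLTRing_LTCoeff hπ) (isLTSeries_LTCoeff π)
        (LTCoeff.of F a) (genPt hπ n) : unitBall (ltField π n)) : ltField π n) := by
  obtain ⟨-, -, hroots⟩ := card_roots_ltPolyIter hπ n
  have hP0 : (((ltPolyIter F π (n + 1)).map (algebraMap 𝒪[F] F)).map
      (algebraMap F (ltField π n))) ≠ 0 :=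
    (((monic_ltPolyIter π (n + 1)).1.map _).map _).ne_zero
  refine hroots _ ?_
  rw [Polynomial.mem_roots hP0, Polynomial.IsRoot.def, Polynomial.eval_map, ← Polynomial.aeval_def,
    Polynomial.aeval_algEquiv, AlgHom.coe_comp, Function.comp_apply]
  change σ (aeval (IntermediateField.AdjoinSimple.gen F (ltRoot π n)) _) = 0
  rw [ltPolyIter_succ_eq_mul, Polynomial.map_mul, aeval_mul, ← minpoly_ltRoot π hπ n,
    IntermediateField.aeval_gen_minpoly, mul_zero, map_zero]

/-- **Every automorphism sends `λ_{n+1}` to a *primitive* division point `[Σ digit(dᵢ) πⁱ] λ_{n+1}`,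
`d₀ ≠ 0`** (`σλ = [a]λ` with `a` a unit: `λ = σ(σ⁻¹λ) = [ab]λ` forces `ab ≡ 1 mod π^{n+1}`).
[cite: deShalit1987, Ch. I §1.8] -/
theorem exists_digits_algEquiv_gen_eq (σ : ltField π n ≃ₐ[F] ltField π n) :
    ∃ d : Fin (n + 1) → 𝓀[F], d 0 ≠ 0 ∧
      σ (IntermediateField.AdjoinSimple.gen F (ltRoot π n)) =
        ((ltSMul (maxNilIdeal F (ltField π n)) (isLTRing_LTCoeff hπ) (isLTSeries_LTCoeff π)
          (LTCoeff.of F (digitSum (π := π) (residueDigit F) d)) (genPt hπ n) :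
            unitBall (ltField π n)) : ltField π n) := by
  have hπm : π ∈ 𝓂[F] := (mem_maximalIdeal_iff_valuation_lt_one _).mpr hπ.val_lt_one
  obtain ⟨a, ha⟩ := exists_algEquiv_gen_eq hπ n σ
  obtain ⟨b, hb⟩ := exists_algEquiv_gen_eq hπ n σ.symm
  obtain ⟨d, hd⟩ := exists_digits hπ (n + 1) a
  refine ⟨d, ?_, by rw [ha, ltSMul_genPt_eq_of_pow_dvd_sub hπ hd]⟩
  -- `λ = [b a] λ`, so `a` is a unit
  have hba : genPt hπ n = ltSMul (maxNilIdeal F (ltField π n)) (isLTRing_LTCoeff hπ)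
      (isLTSeries_LTCoeff π) (LTCoeff.of F (b * a)) (genPt hπ n) := by
    apply Subtype.ext; apply Subtype.ext
    have h1 : (IntermediateField.AdjoinSimple.gen F (ltRoot π n) : ltField π n) =
        σ (σ.symm (IntermediateField.AdjoinSimple.gen F (ltRoot π n))) := (σ.apply_symm_apply _).symm
    have hbpt : mapPt σ.symm (genPt hπ n) = ltSMul (maxNilIdeal F (ltField π n)) (isLTRing_LTCoeff hπ)
        (isLTSeries_LTCoeff π) (LTCoeff.of F b) (genPt hπ n) := Subtype.ext (Subtype.ext hb)
    have hapt : mapPt σ (genPt hπ n) = ltSMul (maxNilIdeal F (ltField π n)) (isLTRing_LTCoeff hπ)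
        (isLTSeries_LTCoeff π) (LTCoeff.of F a) (genPt hπ n) := Subtype.ext (Subtype.ext ha)
    change (IntermediateField.AdjoinSimple.gen F (ltRoot π n) : ltField π n) = _
    rw [h1, hb, ← coe_toUnitBallHom σ, toUnitBallHom_ltSMul, hapt, ← mul_ltSMul, ← map_mul]
  have hdvd := pow_dvd_sub_of_ltSMul_genPt_eq hπ (n := n) (a := 1) (b := b * a)
    (by rw [map_one, one_ltSMul]; exact hba)
  intro hd0
  have hres : IsLocalRing.residue 𝒪[F] a = 0 := by
    have h1 : IsLocalRing.residue 𝒪[F] (a - digitSum (π := π) (residueDigit F) d) = 0 := by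
      rw [IsLocalRing.residue_eq_zero_iff]
      obtain ⟨c, hc⟩ := hd
      rw [hc, pow_succ']
      exact Ideal.mul_mem_right _ _ (Ideal.mul_mem_right _ _ hπm)
    rw [map_sub, residue_digitSum_succ _ hπm, hd0, sub_zero] at h1
    exact h1
  have h2 : IsLocalRing.residue 𝒪[F] (1 - b * a) = 0 := by
    rw [IsLocalRing.residue_eq_zero_iff]
    obtain ⟨c, hc⟩ := hdvd
    rw [hc, pow_succ']
    exact Ideal.mul_mem_right _ _ (Ideal.mul_mem_right _ _ hπm)
  rw [map_sub, map_one, map_mul, hres, mul_zero, sub_zero] at h2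
  exact one_ne_zero h2

/-- The primitive digit vector `d(σ)` of an automorphism: `σ λ_{n+1} = [Σ digit(dᵢ) πⁱ] λ_{n+1}`, `d₀ ≠ 0`.
[cite: deShalit1987, Ch. I §1.8] -/
def galDigits (σ : ltField π n ≃ₐ[F] ltField π n) : {d : Fin (n + 1) → 𝓀[F] // d 0 ≠ 0} :=
  ⟨(exists_digits_algEquiv_gen_eq hπ n σ).choose, (exists_digits_algEquiv_gen_eq hπ n σ).choose_spec.1⟩

/-- Defining property of `galDigits`. [folklore] -/
theorem algEquiv_gen_eq_galDigits (σ : ltField π n ≃ₐ[F] ltField π n) :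
    σ (IntermediateField.AdjoinSimple.gen F (ltRoot π n)) =
      ((ltSMul (maxNilIdeal F (ltField π n)) (isLTRing_LTCoeff hπ) (isLTSeries_LTCoeff π)
        (LTCoeff.of F (digitSum (π := π) (residueDigit F) (galDigits hπ n σ).1)) (genPt hπ n) :
          unitBall (ltField π n)) : ltField π n) :=
  (exists_digits_algEquiv_gen_eq hπ n σ).choose_spec.2

/-- `[Σ digit(dᵢ) πⁱ] λ = [Σ digit(eᵢ) πⁱ] λ ⟹ d = e`. [cite: CasselsFrohlichANT1967, Ch. VI §3.6 Prop. 6 (a)] -/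
theorem digits_injective {m : ℕ} (hm : m ≤ n + 1) : Function.Injective fun d : Fin m → 𝓀[F] =>
    ltSMul (maxNilIdeal F (ltField π n)) (isLTRing_LTCoeff hπ) (isLTSeries_LTCoeff π)
      (LTCoeff.of F (π ^ (n + 1 - m) * digitSum (π := π) (residueDigit F) d)) (genPt hπ n) := by
  intro d e hde
  have h1 := pow_dvd_sub_of_ltSMul_genPt_eq hπ hde
  rw [← mul_sub] at h1
  have h1' : π ^ (n + 1 - m) * π ^ m ∣
      π ^ (n + 1 - m) * (digitSum (π := π) (residueDigit F) d - digitSum (π := π) (residueDigit F) e) := by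
    rwa [← pow_add, show n + 1 - m + m = n + 1 by omega]
  have hπ0 : π ≠ 0 := fun h0 => hπ.ne_zero (congrArg Subtype.val h0)
  have h2 := (mul_dvd_mul_iff_left (pow_ne_zero _ hπ0)).mp h1'
  rw [digitSum_sub] at h2
  exact eq_of_pow_dvd_sum_digits_sub hπ (residue_residueDigit F) m d e h2

/-- **`G(K_π^{n+1}/F) ≅ (𝒪/π^{n+1})ˣ`** in digit form: `σ ↦ d(σ)` is a bijection onto the digit vectors with
`d₀ ≠ 0` (injective since `λ` generates; both sides have `(q-1)q^n` elements).
[cite: CasselsFrohlichANT1967, Ch. VI §3.6 Prop. 6 (b)] -/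
theorem galDigits_bijective : Function.Bijective (galDigits hπ n) := by
  classical
  haveI := isGalois_ltField hπ n
  have hq : 1 < residueFieldCard F := one_lt_residueFieldCard F
  have hcard𝓀 : Fintype.card 𝓀[F] = residueFieldCard F := by
    rw [residueFieldCard, Nat.card_eq_fintype_card]
  rw [Fintype.bijective_iff_injective_and_card]
  refine ⟨fun σ τ h => ?_, ?_⟩
  · -- injective: `σ λ = τ λ`
    apply AlgEquiv.coe_toAlgHom_injective
    refine (IntermediateField.adjoin.powerBasis (isIntegral_ltRoot π n)).algHom_ext ?_
    change σ (IntermediateField.AdjoinSimple.gen F (ltRoot π n)) =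
      τ (IntermediateField.AdjoinSimple.gen F (ltRoot π n))
    rw [algEquiv_gen_eq_galDigits, algEquiv_gen_eq_galDigits, h]
  · -- cardinalities: `(q-1) q^n` on both sides
    rw [← Nat.card_eq_fintype_card, IsGalois.card_aut_eq_finrank, finrank_ltField π hπ n,
      Fintype.card_subtype_compl, Fintype.card_fun, Fintype.card_fin, hcard𝓀]
    have e : {d : Fin (n + 1) → 𝓀[F] // d 0 = 0} ≃ (Fin n → 𝓀[F]) :=
      { toFun := fun d => Fin.tail d.1
        invFun := fun d => ⟨Fin.cons 0 d, by simp⟩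
        left_inv := fun d => by
          apply Subtype.ext
          simp only
          conv_rhs => rw [← Fin.cons_self_tail d.1]
          rw [d.2]
        right_inv := fun d => Fin.tail_cons _ _ }
    rw [Fintype.card_congr e, Fintype.card_fun, Fintype.card_fin, hcard𝓀, pow_succ, Nat.sub_one_mul,
      mul_comm]

/-! #### The norm of `h(λ_{n+1})` through Coleman's operator -/

/-- **`N_{K_π^{n+1}/F}(h(λ)) · (𝒩^{(n)}h)(0) = (𝒩^{(n+1)}h)(0)`** for `h ∈ 𝒪[F]⟦X⟧` (de Shalit's (2) in the
absolute case: the norm is the product of `h` over the primitive division points, and `W_f^{n+1}` is the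
disjoint union of `W_f^n` and the primitive points). [cite: deShalit1987, Ch. I §2.2 (proof, (2))] -/
theorem norm_evalAt_genPt_mul (h : PowerSeries (LTCoeff F)) :
    Algebra.norm F ((evalAt (maxNilIdeal F (ltField π n)) (genPt hπ n) h : unitBall (ltField π n)) :
        ltField π n) * (((LTCoeff.of F).symm (PowerSeries.constantCoeff (colemanNormIter hπ n n h)) : 𝒪[F]) : F)
      = (((LTCoeff.of F).symm (PowerSeries.constantCoeff (colemanNormIter hπ n (n + 1) h)) : 𝒪[F]) : F) := by
  classical
  haveI := isGalois_ltField hπ n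
  set E := ltField π n
  set M := maxNilIdeal F (ltField π n)
  -- shorthand for the division points `[Σ digit(dᵢ) πⁱ] λ` and the values `h(·) ∈ E`
  set P : (Fin (n + 1) → 𝓀[F]) → M.toIdeal := fun d =>
    ltSMul M (isLTRing_LTCoeff hπ) (isLTSeries_LTCoeff π)
      (LTCoeff.of F (digitSum (π := π) (residueDigit F) d)) (genPt hπ n) with hP
  set Φ : M.toIdeal → E := fun x => ((evalAt M x h : unitBall E) : E) with hΦ
  apply (algebraMap F E).injective
  rw [map_mul, Algebra.norm_eq_prod_automorphisms]
  -- (1) the norm as a product over the primitive points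
  have h1 : ∏ σ : E ≃ₐ[F] E, σ (Φ (genPt hπ n)) =
      ∏ d ∈ Finset.univ.filter (fun d : Fin (n + 1) → 𝓀[F] => d 0 ≠ 0), Φ (P d) := by
    have hσ : ∀ σ : E ≃ₐ[F] E, σ (Φ (genPt hπ n)) = Φ (P (galDigits hπ n σ).1) := by
      intro σ
      have hpt : mapPt σ (genPt hπ n) = P (galDigits hπ n σ).1 :=
        Subtype.ext (Subtype.ext (algEquiv_gen_eq_galDigits hπ n σ))
      simp only [hΦ]
      rw [← coe_toUnitBallHom σ, algHom_evalAt M M (toUnitBallHom σ) (continuous_toUnitBallHom σ) h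
        (genPt hπ n) (mapPt σ (genPt hπ n)) rfl, hpt]
    simp_rw [hσ]
    rw [(galDigits_bijective hπ n).prod_comp (fun s : {d : Fin (n + 1) → 𝓀[F] // d 0 ≠ 0} => Φ (P s.1))]
    exact (Finset.prod_subtype _ (fun d => by
      rw [Finset.mem_filter]; exact ⟨fun h => h.2, fun h => ⟨Finset.mem_univ _, h⟩⟩) (fun d => Φ (P d))).symm
  -- (2) the two constant coefficients as products over all points of levels `n+1` and `n`
  have h2 : algebraMap F E ((((LTCoeff.of F).symm (PowerSeries.constantCoeff
      (colemanNormIter hπ n (n + 1) h)) : 𝒪[F]) : F)) = ∏ d : Fin (n + 1) → 𝓀[F], Φ (P d) := by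
    have e := congrArg (fun s : unitBall E => (s : E))
      (prod_evalAt_eq_constantCoeff_colemanNormIter hπ n (n + 1) le_rfl h)
    rw [coe_algebraMap_LTCoeff, SubmonoidClass.coe_finsetProd] at e
    rw [← e]
    refine Finset.prod_congr rfl fun d _ => ?_
    simp only [hΦ, hP, Nat.sub_self, pow_zero, one_mul]
    rfl
  have h3 : algebraMap F E ((((LTCoeff.of F).symm (PowerSeries.constantCoeff
      (colemanNormIter hπ n n h)) : 𝒪[F]) : F)) =
      ∏ d ∈ Finset.univ.filter (fun d : Fin (n + 1) → 𝓀[F] => d 0 = 0), Φ (P d) := by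
    have e := congrArg (fun s : unitBall E => (s : E))
      (prod_evalAt_eq_constantCoeff_colemanNormIter hπ n n n.le_succ h)
    rw [coe_algebraMap_LTCoeff, SubmonoidClass.coe_finsetProd] at e
    rw [← e]
    -- reindex `d' ↦ (0, d')`
    refine Finset.prod_nbij' (fun d' : Fin n → 𝓀[F] => (Fin.cons 0 d' : Fin (n + 1) → 𝓀[F]))
      (fun d => Fin.tail d) (fun d' _ => ?_) (fun d _ => Finset.mem_univ _) (fun d' _ => Fin.tail_cons _ _)
      (fun d hd => ?_) (fun d' _ => ?_)
    · rw [Finset.mem_filter]; exact ⟨Finset.mem_univ _, Fin.cons_zero _ _⟩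
    · rw [Finset.mem_filter] at hd
      conv_rhs => rw [← Fin.cons_self_tail d]
      rw [hd.2]
    · simp only [hΦ, hP]
      rw [digitSum_cons_zero, show n + 1 - n = 1 by omega, pow_one]
  rw [h1, h3, h2, mul_comm]
  exact Finset.prod_filter_mul_prod_filter_not _ _ _


/-- **The norm of `h(λ_{n+1})` for `h ∈ 𝒪[F]⟦X⟧ˣ`**: `N_{K_π^{n+1}/F}(h(λ)) = (𝒩^{(n)} g)(0) ≡ 1 (mod π^{n+1})`
where `g = 𝒩h / h ≡ 1 (mod π)` (de Shalit's (2)–(3) in the absolute case).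
[cite: deShalit1987, Ch. I §2.2 (proof, (2)–(3))] -/
theorem exists_norm_evalAt_genPt_eq (h : PowerSeries (LTCoeff F)) (hh : IsUnit (PowerSeries.constantCoeff h)) :
    ∃ a : 𝒪[F], π ^ (n + 1) ∣ a - 1 ∧
      Algebra.norm F ((evalAt (maxNilIdeal F (ltField π n)) (genPt hπ n) h : unitBall (ltField π n)) :
        ltField π n) = (a : F) := by
  have hu : IsUnit h := PowerSeries.isUnit_iff_constantCoeff.mpr hh
  obtain ⟨u, rfl⟩ := hu
  set g := colemanNorm hπ n (↑u : PowerSeries (LTCoeff F)) * ↑u⁻¹ with hg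
  have hgu : colemanNorm hπ n (↑u : PowerSeries (LTCoeff F)) = g * ↑u := by
    rw [hg, mul_assoc, Units.inv_mul, mul_one]
  have hg1 : g - 1 ∈ coeffIdeal (Ideal.span {LTCoeff.of F π}) := by
    have := Ideal.mul_mem_right (↑u⁻¹ : PowerSeries (LTCoeff F)) _
      (colemanNorm_sub_mem_coeffIdeal hπ n (↑u : PowerSeries (LTCoeff F)))
    rwa [sub_mul, Units.mul_inv, ← hg] at this
  have hNg := colemanNormIter_sub_one_mem hπ n n hg1
  refine ⟨(LTCoeff.of F).symm (PowerSeries.constantCoeff (colemanNormIter hπ n n g)), ?_, ?_⟩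
  · have h0 := hNg 0
    rw [PowerSeries.coeff_zero_eq_constantCoeff_apply, map_sub, map_one, Ideal.mem_span_singleton] at h0
    obtain ⟨c, hc⟩ := h0
    refine ⟨(LTCoeff.of F).symm c, (LTCoeff.of F).injective ?_⟩
    rw [map_sub, map_one, map_mul, map_pow, RingEquiv.apply_symm_apply, RingEquiv.apply_symm_apply]
    exact hc
  · have key := norm_evalAt_genPt_mul hπ n (↑u : PowerSeries (LTCoeff F))
    rw [colemanNormIter_succ, hgu, colemanNormIter_mul, map_mul, map_mul, Subring.coe_mul] at key
    have hne : (((LTCoeff.of F).symm (PowerSeries.constantCoeff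
        (colemanNormIter hπ n n (↑u : PowerSeries (LTCoeff F)))) : 𝒪[F]) : F) ≠ 0 := by
      have hU : IsUnit ((LTCoeff.of F).symm (PowerSeries.constantCoeff
          (colemanNormIter hπ n n (↑u : PowerSeries (LTCoeff F))))) :=
        (PowerSeries.isUnit_iff_constantCoeff.mp (isUnit_colemanNormIter hπ n n u.isUnit)).map _
      intro h0
      exact hU.ne_zero (Subtype.ext h0)
    exact mul_right_cancel₀ hne key

/-- **`𝒪_{K_π^{n+1}} = 𝒪_F[λ_{n+1}]` with unit constant term on units**: every `y ∈ K_π^{n+1}` with `‖y‖ = 1` is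
`h(λ_{n+1})` for some `h ∈ 𝒪[F][X] ⊆ 𝒪[F]⟦X⟧` with `h(0) ∈ 𝒪[F]ˣ` (all coordinates in the power basis are
integral, and the constant one is the dominant term).
Ref: Serre, *Local Fields* (1979), Ch. I §6 Prop. 17–18; de Shalit I §1.8 (`ω` is a prime element).
[cite: SerreLocalFields1979, Ch. I §6 Prop. 18] -/
theorem exists_series_of_norm_eq_one (y : ltField π n) (hy : ‖y‖ = 1) :
    ∃ h : PowerSeries (LTCoeff F), IsUnit (PowerSeries.constantCoeff h) ∧
      ((evalAt (maxNilIdeal F (ltField π n)) (genPt hπ n) h : unitBall (ltField π n)) : ltField π n) = y := by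
  classical
  have hq : 1 < residueFieldCard F := one_lt_residueFieldCard F
  have hint := isIntegral_ltRoot π n
  set pb : PowerBasis F (ltField π n) := IntermediateField.adjoin.powerBasis hint with hpb
  have hpbgen : pb.gen = IntermediateField.AdjoinSimple.gen F (ltRoot π n) :=
    IntermediateField.adjoin.powerBasis_gen hint
  have hpbdim : pb.dim = (residueFieldCard F - 1) * residueFieldCard F ^ n := by
    rw [hpb, IntermediateField.adjoin.powerBasis_dim, minpoly_ltRoot π hπ n,
      (monic_ltPolyDiv π n).1.natDegree_map, (monic_ltPolyDiv π n).2.1]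
  have hdpos : 0 < pb.dim := by rw [hpbdim]; exact Nat.mul_pos (by omega) (pow_pos (by omega) _)
  -- spectral data
  have hπn0 : 0 < ‖(π : F)‖ := norm_pos_iff.mpr hπ.ne_zero
  have hπn1 : ‖(π : F)‖ < 1 := (Valued.toNormedField.norm_lt_one_iff).mpr hπ.val_lt_one
  have hval : ∀ x : F, x ≠ 0 → ∃ k : ℤ, ‖x‖ = ‖(π : F)‖ ^ k := fun x hx => exists_norm_eq_norm_zpow hπ hx
  have hα : spectralNorm F (ltField π n) pb.gen ^ pb.dim = ‖(π : F)‖ := by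
    rw [hpbgen, hpbdim, ← norm_eq_spectralNorm F (ltField π n)]
    exact norm_gen_ltField_pow hπ n
  have ht : 0 < spectralNorm F (ltField π n) pb.gen := by
    rcases (spectralNorm_nonneg (K := F) pb.gen).eq_or_lt with h | h
    · exfalso
      rw [← h, zero_pow hdpos.ne'] at hα
      exact hπn0.ne hα
    · exact h
  have hy' : spectralNorm F (ltField π n) y = 1 := by rw [← norm_eq_spectralNorm F (ltField π n), hy]
  set c := pb.basis.repr y with hc
  -- all coordinates are integral
  have hc1 : ∀ i, ‖c i‖ ≤ 1 := fun i =>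
    norm_le_one_of_norm_mul_pow_le hπn0 hπn1 hval ht hα i.2
      ((norm_repr_mul_pow_le hπn0 hπn1 hval pb hα y i).trans hy'.le)
  -- the constant coordinate is a unit
  have hc0 : ‖c ⟨0, hdpos⟩‖ = 1 := by
    have hy0 : y ≠ 0 := by intro h0; rw [h0, norm_zero] at hy; exact zero_ne_one hy
    obtain ⟨i₀, hci₀, hnorm, -⟩ := exists_dominant_term F (ltField π n) hπn0 hπn1 hval pb hα hy0
    have hi₀ : (i₀ : ℕ) = 0 :=
      eq_of_norm_mul_pow_eq hπn0 hπn1 hval ht hα hci₀ one_ne_zero i₀.2 hdpos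
        (by rw [norm_one, pow_zero, one_mul, ← hnorm, hy'])
    have hi₀' : i₀ = ⟨0, hdpos⟩ := Fin.ext hi₀
    rw [← hi₀']
    have := hnorm
    rw [hi₀, pow_zero, mul_one, hy'] at this
    exact this.symm
  -- the polynomial `p = Σ c_i X^i ∈ 𝒪[F][X]`
  set a : Fin pb.dim → 𝒪[F] := fun i => ⟨c i, (Valued.toNormedField.norm_le_one_iff).mp (hc1 i)⟩ with ha
  set p : 𝒪[F][X] := ∑ i : Fin pb.dim, Polynomial.C (a i) * Polynomial.X ^ (i : ℕ) with hp
  refine ⟨((p.map (LTCoeff.of F).toRingHom : (LTCoeff F)[X]) : PowerSeries (LTCoeff F)), ?_, ?_⟩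
  · -- constant coefficient `a 0`, a unit
    rw [← PowerSeries.coeff_zero_eq_constantCoeff_apply, Polynomial.coeff_coe, Polynomial.coeff_map]
    have hp0 : p.coeff 0 = a ⟨0, hdpos⟩ := by
      rw [hp, Polynomial.finsetSum_coeff]
      simp only [Polynomial.coeff_C_mul_X_pow]
      rw [Finset.sum_eq_single ⟨0, hdpos⟩ (fun i _ hi => if_neg fun h0 => hi (Fin.ext h0.symm))
        (fun h => absurd (Finset.mem_univ _) h), if_pos rfl]
    rw [hp0]
    have hau : IsUnit (a ⟨0, hdpos⟩) := by
      refine (Valuation.Integers.isUnit_iff_valuation_eq_one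
        (Valuation.integer.integers (valuation F))).mpr ?_
      change valuation F (c ⟨0, hdpos⟩) = 1
      have h1 := hc0
      rw [le_antisymm_iff, Valued.toNormedField.norm_le_one_iff, Valued.toNormedField.one_le_norm_iff,
        ← le_antisymm_iff] at h1
      exact h1
    exact hau.map _
  · -- the value at `λ` is `y`
    rw [evalAt_apply, PowerSeries.aeval_coe, aeval_LTCoeff_eq, coe_aeval_integer]
    conv_rhs => rw [← pb.basis.sum_repr y]
    rw [hp, Polynomial.map_sum, map_sum]
    refine Finset.sum_congr rfl fun i _ => ?_
    rw [Polynomial.map_mul, Polynomial.map_pow, Polynomial.map_C, Polynomial.map_X, map_mul, map_pow,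
      Polynomial.aeval_C, Polynomial.aeval_X, PowerBasis.coe_basis, Algebra.smul_def, hpbgen]
    rfl

include hπ in
/-- **Norms of units of `K_π^{n+1}` lie in `U_F^{(n+1)}`**: `N_{K_π^{n+1}/F}(𝒪_{K_π^{n+1}}ˣ) ⊆ 1 + π^{n+1}𝒪_F`
(Coleman's norm operator: `N(h(λ)) = (𝒩^{(n)}(𝒩h/h))(0) ≡ 1 mod π^{n+1}`).
[cite: deShalit1987, Ch. I §2.2 (proof, (2)–(3))] -/
theorem exists_norm_mem_higherUnitGroup (y : ltField π n) (hy : ‖y‖ = 1) :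
    ∃ hy0 : Algebra.norm F y ≠ 0, Units.mk0 _ hy0 ∈ higherUnitGroup F (n + 1) := by
  obtain ⟨h, hh, hyh⟩ := exists_series_of_norm_eq_one hπ n y hy
  obtain ⟨a, ha, hN⟩ := exists_norm_evalAt_genPt_eq hπ n h hh
  rw [hyh] at hN
  have hπv : valuation F (π : F) = unifValue F := hπ
  have hv : valuation F ((a : F) - 1) ≤ unifValue F ^ (n + 1) := by
    obtain ⟨c, hc⟩ := ha
    have e : (a : F) - 1 = (π : F) ^ (n + 1) * (c : F) := by
      have := congrArg Subtype.val hc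
      simpa using this
    rw [e, Valuation.map_mul, Valuation.map_pow, hπv]
    exact mul_le_of_le_one_right' c.2
  have ha0 : (a : F) ≠ 0 := by
    intro h0
    rw [h0, zero_sub, Valuation.map_neg, Valuation.map_one] at hv
    exact not_lt.mpr hv (pow_lt_one₀ (unifValue_pos F).le (unifValue_lt_one F) (Nat.succ_ne_zero n))
  refine ⟨by rw [hN]; exact ha0, ?_⟩
  rw [mem_higherUnitGroup_iff_of_pos F (Nat.succ_pos n), Units.val_mk0, hN]
  exact hv

end NormComputation

/-! ### The Lubin–Tate norm-group fact, proved -/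

/-- **Norm groups of the Lubin–Tate extensions (containment half), proved**: the named fact
`exists_abelian_norm_le_lubinTate F` of `LocalExistenceLubinTate.lean` — for every uniformizer `π` of the
non-archimedean local field `F` and `n ≥ 1` there is a finite abelian `E ⊆ F̄` of degree `(q-1)q^{n-1}` with
`π ∈ N(Eˣ)` and `N(Eˣ) ⊆ ⟨π⟩ · U_F^{(n)}`, namely `E = K_π^n` (`ltField π (n-1)`): abelian by
`isAbelianGalois_ltField`, `N(-λ_n) = π` (`norm_neg_gen_ltField`), and every `x ∈ Eˣ` is
`(-λ_n)^i π^k u` with `‖u‖ = 1` (`exists_eq_pow_mul_mul_one_add`: `E/F` is totally ramified), where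
`N(u) ∈ U^{(n)}` by Coleman's norm operator (`exists_norm_mem_higherUnitGroup`).
Ref: Cassels–Fröhlich (1967), Ch. VI §3.6 Prop. 6, Cor., §3.8; de Shalit (1987), Ch. I §1.8, §2.1–2.2.
[cite: CasselsFrohlichANT1967, Ch. VI §3.6 Cor. to Prop. 6 and §3.8] -/
theorem exists_abelian_norm_le_lubinTate_holds : exists_abelian_norm_le_lubinTate F := by
  intro ϖ hϖ n hn
  classical
  obtain ⟨m, rfl⟩ : ∃ m, n = m + 1 := ⟨n - 1, by omega⟩
  have hq : 1 < residueFieldCard F := one_lt_residueFieldCard F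
  set π : 𝒪[F] := ⟨(ϖ : F), hϖ.val_lt_one.le⟩ with hπ_def
  have hπ : (valuation F).IsUniformizer (π : F) := hϖ
  haveI := isGalois_ltField hπ m
  refine ⟨ltField π m, inferInstance, isAbelianGalois_ltField hπ m, ?_, ?_, ?_⟩
  · rw [finrank_ltField π hπ m, Nat.add_sub_cancel]
  · have h := mem_range_norm_ltField π hπ ϖ.ne_zero m
    have e : Units.mk0 (π : F) ϖ.ne_zero = ϖ := Units.ext rfl
    rwa [e] at h
  · rintro _ ⟨x, rfl⟩
    -- the power basis `1, λ, …, λ^{d-1}` and the spectral data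
    have hint := isIntegral_ltRoot π m
    set pb : PowerBasis F (ltField π m) := IntermediateField.adjoin.powerBasis hint with hpb
    have hpbgen : pb.gen = IntermediateField.AdjoinSimple.gen F (ltRoot π m) :=
      IntermediateField.adjoin.powerBasis_gen hint
    have hpbdim : pb.dim = (residueFieldCard F - 1) * residueFieldCard F ^ m := by
      rw [hpb, IntermediateField.adjoin.powerBasis_dim, minpoly_ltRoot π hπ m,
        (monic_ltPolyDiv π m).1.natDegree_map, (monic_ltPolyDiv π m).2.1]
    have hπn0 : 0 < ‖(ϖ : F)‖ := norm_pos_iff.mpr ϖ.ne_zero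
    have hπn1 : ‖(ϖ : F)‖ < 1 := (Valued.toNormedField.norm_lt_one_iff).mpr hϖ.val_lt_one
    have hval : ∀ x : F, x ≠ 0 → ∃ k : ℤ, ‖x‖ = ‖(ϖ : F)‖ ^ k := fun x hx => exists_norm_eq_norm_zpow hπ hx
    have hα : spectralNorm F (ltField π m) pb.gen ^ pb.dim = ‖(ϖ : F)‖ := by
      rw [hpbgen, hpbdim, ← norm_eq_spectralNorm F (ltField π m)]
      exact norm_gen_ltField_pow hπ m
    -- `x = λ^i π^k b (1 + mm) = (-λ)^i π^k u`, `‖u‖ = 1`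
    obtain ⟨i, k, b, mm, hb, hmm, hx⟩ := exists_eq_pow_mul_mul_one_add hπn0 hπn1 hval pb hα x.ne_zero
    set u : ltField π m := (-1) ^ i * algebraMap F (ltField π m) b * (1 + mm) with hu
    have hu1 : ‖u‖ = 1 := by
      have h1 : ‖(1 : ltField π m) + mm‖ = 1 := by
        have hmm' : ‖mm‖ < 1 := by rw [norm_eq_spectralNorm F (ltField π m)]; exact hmm
        rw [IsUltrametricDist.norm_add_eq_max_of_norm_ne_norm (by rw [norm_one]; exact hmm'.ne'),
          norm_one, max_eq_left hmm'.le]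
      rw [hu, norm_mul, norm_mul, norm_pow, norm_neg, norm_one, one_pow, one_mul, h1, mul_one,
        norm_eq_spectralNorm F (ltField π m), spectralNorm_extends, hb]
    have hxu : (x : ltField π m) = (-pb.gen) ^ i * algebraMap F (ltField π m) ((ϖ : F) ^ k) * u := by
      have e1 : (-pb.gen) ^ i * (-1) ^ i = pb.gen ^ i := by rw [← mul_pow, mul_neg_one, neg_neg]
      rw [hx, hu, map_mul, map_zpow₀, ← e1]
      ring
    clear_value u
    obtain ⟨hN0, hNu⟩ := exists_norm_mem_higherUnitGroup hπ m u hu1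
    have hNg : Algebra.norm F (-pb.gen) = (ϖ : F) := by rw [hpbgen]; exact norm_neg_gen_ltField π hπ m
    refine Subgroup.mem_sup.mpr ⟨ϖ ^ ((i : ℤ) + k * (Module.finrank F (ltField π m) : ℤ)),
      Subgroup.zpow_mem _ (Subgroup.mem_zpowers ϖ) _, Units.mk0 _ hN0, hNu, Units.ext ?_⟩
    rw [Units.val_mul, Units.val_zpow_eq_zpow_val, Units.val_mk0, Units.coe_map, hxu,
      map_mul, map_mul, map_pow, hNg, Algebra.norm_algebraMap, zpow_add₀ ϖ.ne_zero, zpow_natCast, zpow_mul,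
      zpow_natCast]


/-- **The universal norm group of a non-archimedean local field is trivial** — Serre XIV §6 Cor. 2 (i)
to Thm. 1, here **proved without the reciprocity law**: a universal norm `x` is a norm from the unramified
extensions of degree divisible by any `r` (`exists_abelian_norm_eq_pow_mul`: norms are `a^{[E:F]} c`, `c` a
unit), so `v(x) = 0`; and a norm from every `K_π^n`, so `x ∈ ⟨π⟩ · U^{(n)}`
(`exists_abelian_norm_le_lubinTate_holds`), i.e. `x ∈ U^{(n)}` for all `n`, whence `x = 1`.  (Serre derives
Cor. 2 from Thm. 1 with the groups `V_{m,n} = ⟨π^m, U^{(n)}⟩`; the two families of norm groups used here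
are exactly those that make the `V_{m,n}` norm groups.)
[cite: SerreLocalFields1979, Ch. XIV §6 Cor. 2 (i)] -/
theorem universalNormSubgroup_eq_bot : universalNormSubgroup F = ⊥ := by
  rw [eq_bot_iff]
  intro x hx
  rw [Subgroup.mem_bot]
  rw [mem_universalNormSubgroup_iff] at hx
  obtain ⟨ϖ, hϖ⟩ := exists_isUniformizer F
  have hϖv : valuation F (ϖ : F) = unifValue F := hϖ
  -- (1) `v(x) = 1`, from the unramified norm groups
  have hvx : valuation F (x : F) = 1 := by
    obtain ⟨k, hk⟩ := exists_valuation_eq_unifValue_zpow F x.ne_zero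
    obtain ⟨E, hfd, hab, ⟨t, ht⟩, hN⟩ := exists_abelian_norm_eq_pow_mul F (k.natAbs + 1) (Nat.succ_pos _)
    haveI := hfd
    haveI := hab
    obtain ⟨y, hy⟩ := hx _ (isNormSubgroup_range F E)
    obtain ⟨a, c, ha, hc, hNy⟩ := hN (y : E) y.ne_zero
    obtain ⟨j, hj⟩ := exists_valuation_eq_unifValue_zpow F ha
    have hval : unifValue F ^ k = unifValue F ^ (j * ((k.natAbs + 1) * t : ℕ)) := by
      rw [← hk, ← hy, Units.coe_map]
      change valuation F (Algebra.norm F (y : E)) = _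
      rw [hNy, Valuation.map_mul, Valuation.map_pow, hc, mul_one, hj, ← zpow_natCast, ← zpow_mul, ht]
    have hkj : k = j * ((k.natAbs + 1) * t : ℕ) :=
      zpow_right_injective₀ (unifValue_pos F) (unifValue_lt_one F).ne hval
    have ht0 : 0 < t := by
      have h0 : 0 < Module.finrank F E := Module.finrank_pos
      rw [ht] at h0
      exact Nat.pos_of_mul_pos_left h0
    have hj0 : j = 0 := by
      by_contra hj0
      have h1 : k.natAbs = j.natAbs * ((k.natAbs + 1) * t) := by
        have := congrArg Int.natAbs hkj
        rwa [Int.natAbs_mul, Int.natAbs_natCast] at this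
      have h2 : 1 ≤ j.natAbs := Int.natAbs_pos.mpr hj0
      have h3 : (k.natAbs + 1) * t ≤ j.natAbs * ((k.natAbs + 1) * t) := Nat.le_mul_of_pos_left _ h2
      have h4 : k.natAbs + 1 ≤ (k.natAbs + 1) * t := Nat.le_mul_of_pos_right _ ht0
      exact Nat.not_succ_le_self _ (h4.trans (h3.trans h1.symm.le))
    rw [hk, hkj, hj0, zero_mul, zpow_zero]
  -- (2) `x ∈ U^{(n)}` for every `n ≥ 1`, from the Lubin–Tate norm groups
  have hxU : ∀ n, 0 < n → x ∈ higherUnitGroup F n := by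
    intro n hn
    obtain ⟨E, hfd, hab, -, -, hle⟩ := exists_abelian_norm_le_lubinTate_holds F ϖ hϖ n hn
    haveI := hfd
    haveI := hab
    obtain ⟨y, hy, u, hu, hyu⟩ := Subgroup.mem_sup.mp (hle (hx _ (isNormSubgroup_range F E)))
    obtain ⟨m, rfl⟩ := Subgroup.mem_zpowers_iff.mp hy
    have hm : m = 0 := by
      have h1 : valuation F (x : F) = unifValue F ^ m := by
        rw [← hyu, Units.val_mul, Units.val_zpow_eq_zpow_val, Valuation.map_mul, map_zpow₀, hϖv,
          (mem_higherUnitGroup_iff.mp hu).1, mul_one]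
      rw [hvx, ← zpow_zero (unifValue F)] at h1
      exact (zpow_right_injective₀ (unifValue_pos F) (unifValue_lt_one F).ne h1).symm
    rw [hm, zpow_zero, one_mul] at hyu
    rw [← hyu]
    exact hu
  -- (3) `⋂ₙ U^{(n)} = 1`
  by_contra hx1
  have hx1' : (x : F) - 1 ≠ 0 := sub_ne_zero.mpr fun h => hx1 (Units.ext h)
  obtain ⟨k, hk⟩ := exists_valuation_eq_unifValue_zpow F hx1'
  have hmem := (mem_higherUnitGroup_iff.mp (hxU (k.toNat + 1) (Nat.succ_pos _))).2
  rw [hk, ← zpow_natCast, zpow_le_zpow_iff_right_of_lt_one₀ (unifValue_pos F) (unifValue_lt_one F)] at hmem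
  have hk' : k ≤ k.toNat := Int.self_le_toNat k
  push_cast at hmem
  omega

/-- **The existence theorem of local class field theory from the reciprocity law alone.**  For a
non-archimedean local field `F`, granting the local reciprocity law `localReciprocityLaw F` (Serre,
*Local Fields*, XIII §4: `θ_E : Fˣ/N(Eˣ) ≅ G(E/F)` for finite abelian `E`, compatibly in towers), every
open subgroup of finite index of `Fˣ` is a norm group — Serre XIV §6 Thm. 1 — by the argument of
Cassels–Fröhlich VI §3.8 (`localExistenceTheorem_of_reciprocityLaw_of_lubinTate`) with the Lubin–Tate
norm-group fact now proved (`exists_abelian_norm_le_lubinTate_holds`).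
[cite: SerreLocalFields1979, Ch. XIV §6 Thm. 1] -/
theorem localExistenceTheorem_of_localReciprocityLaw (hrec : localReciprocityLaw F) :
    localExistenceTheorem F :=
  localExistenceTheorem_of_reciprocityLaw_of_lubinTate F hrec (exists_abelian_norm_le_lubinTate_holds F)

/-- The trunk predicate `exists_intermediateField_normSubgroup_eq F` (Serre XIV §6 Thm. 1, as vendored in
`LocalClassFieldTheory.lean`; definitionally `localExistenceTheorem F` on a non-archimedean local field) from
the local reciprocity law alone. [cite: SerreLocalFields1979, Ch. XIV §6 Thm. 1] -/
theorem exists_intermediateField_normSubgroup_eq_of_localReciprocityLaw (hrec : localReciprocityLaw F) :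
    exists_intermediateField_normSubgroup_eq F :=
  localExistenceTheorem_of_localReciprocityLaw F hrec

end LocalFieldC
end Literature.NumberTheory.GaloisRepresentations
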